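import Summits.ResolutionOfSingularities.ResolutionOfSingularities.Theorems.WildConesCampaignW46ForcedAtomTerminates
import HarnessLib

/-!
# [OURS · L1 W4.6, rung (i)/(all `n`)] The FORCED-ATOM REGIME of the typed Th. 16.6 procedure, NAMED, and its rung CLOSED BY NAME
# (cell res-hironaka, LADDER-RESOLUTION rung L, D-0089; slot W4.6; host route `WildCones`, crux `ClassicalRegimes`
# stmt-ResolutionOfSingularities-16884, `--supports … --as helper`; OURS typer res-L1-type-o1 on res-L1-s46-pv-2's ASK 2026-08-27T08:56:16Z)

HONEST FRAMING. Everything below is OURS. NOTHING here is a statement of H. Hironaka's manuscript *Resolution of singularities in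
positive characteristics* (2017-03-23, [Hironaka2017]) and nothing asserts that any statement of it holds: the typed Th. 16.6
procedure (`CampaignW46.Run`, `Terminates`, `TerminatesNabla`, `Regime` — `Theorems/MarkedTransferCampaignW46TypedProcedure.lean`) and
the candidate carriers (`AmbientDatum`, `IdealExponent`, `.sing`, `stalkIdeal`) enter as DEFINITIONS; the coefficient calculus is route
`WildCones`' own (`WildCones.ser`, `WildCones.Isol`, `Theorems/WildConesClassicalRegimesDefs.lean`). No FACT-LIST premise is used. AI review
is weaker than expert review.

## What this file does

res-L1-s46-pv-2 proved (p516034, `Theorems/WildConesCampaignW46ForcedAtomTerminates.lean`) the definition-free, antitone form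
`CampaignW46.ForcedAtom.terminates_of_le_forcedAtom (hn : 0 < n) N Rd Rg (hRg : Rg ≤ «forced-atom class») : Terminates N Rd Rg` over an
algebraically closed field `K` of characteristic `p` (universe `0`, forced by the `WildCones` calculus). This file (typer's word, as
announced in that file's docstring):

* §1 `Regime.forcedAtom n : Regime p K` — [OURS · L1 W4.6 rung (i)/(all `n`)] THE FORCED-ATOM CLASS AS A NAMED REGIME, body = the
  hypothesis `hRg` of `terminates_of_le_forcedAtom` VERBATIM: at a state `(A, E)`, `E.b = p`; `Sing(E)` has at most one point; and at every
  `ξ ∈ Sing(E)` the local ring `𝒪_{Z,ξ}` has embedding dimension `n + 1`, SOME ring isomorphism `E₀ : 𝒪̂_{Z,ξ} ≃+* K⟦z, u₁, …, uₙ⟧` carries a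
  generator `f₀` of `J_ξ` to a unit times the height-one atom `z^p − ser c₀` of the `WildCones` dynamics, and EVERY such presentation has
  `Isol c₀` (finite Milnor algebra). Replaces the role of the restriction «regime (i): the forced / isolated `p`-fold hypersurface points
  `z^p = a(u)` in any dimension» of RESCUE-SEED W4.6 read on the state of the typed procedure (DESIGN POINT (REG) of the typed-procedure
  module); NOT a statement of the manuscript.
* §2 `ForcedAtomTerminates p K n : Prop` / `ForcedAtomTerminatesNabla p K n : Prop` — the rung and its ∇-centred twin, in the shape of
  `PlaneIsolatedTerminates` / `MohWindowSurfaceTameTerminates` (every `m`, every notion instance `N : Notions.{0} m`, every reading `Rd`).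
* §3 CLOSED BY NAME: `forcedAtomTerminates_holds (hn : 0 < n) : ForcedAtomTerminates p K n` for `K` algebraically closed — literally
  `terminates_of_le_forcedAtom hn N Rd _ (fun _ _ h => h)` — and the ∇-twin via `terminatesNabla_of_terminates`.

VACUITY (typer's self-check). (a) `Regime.forcedAtom n` is NOT the empty regime by design: e.g. on `Z = 𝔸^{n+1}_K` the exponent
`E = ((z^p + u₁^{p+1} + ⋯ + uₙ^{p+1}), p)` has `Sing(E) = {0}` (order `p` exactly at the origin), embedding dimension `n + 1` there, the
completion presentation with `c₀` = the coefficient function of `u₁^{p+1} + ⋯ + uₙ^{p+1}` (`p ∤ p + 1`, so cleaning keeps it) and a finite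
Milnor algebra `K⟦u⟧/(u₁^p, …, uₙ^p)` in EVERY presentation (Tjurina/Milnor finiteness is invariant under `≃+*` and units — res-L1-s46-pv-2's
bricks 11/11b for `K`-algebra changes; for bare ring isomorphisms this is the disclosed «NOT COVERED» item of p516034, which makes the
regime SMALLER, never vacuous-true); an in-kernel state witness is NOT constructed in this file (the (i-a) witness-file pattern,
`…FiniteExitBoundWitness.lean`, applies if a desk asks). (b) `Terminates N Rd Rg` is trivially true when no run of `(N, Rd)` stays in `Rg`;
that generic feature of every regime rung is unchanged here and is exactly why (a) matters. (c) `n = 0` (plane curves `z^p = a`, no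
`u`-variables) is admitted by the definition but excluded from the closer (`0 < n`), as in p516034: there the calculus' `MultP` is empty.
(d) `K` is any field of characteristic `p` in §1–§2 (universe `0`); the closer §3 needs `K` algebraically closed (p516034's rationality
brick 7′); perfect non-closed `K` is OPEN here (disclosed in p516034 «NOT COVERED»).

References: res-L1-s46-pv-2's bricks 1–12 and assembly (`Theorems/WildConesCampaignW46*.lean`, p516034); the typed procedure
(`…W46TypedProcedure.lean` p479675, `…TypedProcedureAnchors.lean` p480427); RESCUE-SEED W4.6 row (plan/RESCUE-SEED.md); H. Hironaka,
ms. 2017, Th. 16.6 p.84 (role only; nothing asserted). [cite: Matsumura1987, Thm. 8.11] (completions, as in p516034).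
-/

noncomputable section

-- single-problem summit: the doubled namespace component `ResolutionOfSingularities` is forced
set_option linter.dupNamespace false

open scoped BigOperators Classical
open MvPowerSeries IsLocalRing

namespace Summit.ResolutionOfSingularities.ResolutionOfSingularities.Theorems

namespace CampaignW46

open CategoryTheory AlgebraicGeometry TopologicalSpace
open Literature.AlgebraicGeometry.Resolution
open Literature.AlgebraicGeometry.Hironaka2017.S02Preliminaries
open Scheme.IdealSheafData
open WildCones

variable {p : ℕ} [Fact p.Prime] {K : Type} [Field K] [CharP K p]

/-! ## §1 The forced-atom regime -/

/-- [OURS · L1 W4.6 rung (i)/(all `n`)] **Regime «forced atom in `n + 1` variables»** — replaces the role of the restriction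
«regime (i): forced (isolated) `p`-fold hypersurface points `z^p = a(u₁, …, uₙ)`» of RESCUE-SEED W4.6, read on the state `(A, E)` of the
typed Th. 16.6 procedure at EVERY stage (DESIGN POINT (REG)); NOT a statement of the manuscript. Body = the hypothesis `hRg` of
res-L1-s46-pv-2's `ForcedAtom.terminates_of_le_forcedAtom` (p516034) VERBATIM: `E.b = p`; `Sing(E)` is a subsingleton; at every
`ξ ∈ Sing(E)`: the maximal ideal of `𝒪_{Z,ξ}` has `spanFinrank = n + 1`, SOME `E₀ : 𝒪̂_{Z,ξ} ≃+* K⟦z,u⟧` presents a generator `f₀` of `J_ξ`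
as `w₀ · (z^p − ser c₀)` with `w₀` a unit, and EVERY such presentation `(E₀, f₀, c₀, w₀)` has `WildCones.Isol p n K c₀`. See the module
docstring, VACUITY (a)–(d). [folklore] -/
def Regime.forcedAtom (n : ℕ) : Regime p K := fun A E =>
  E.b = p ∧ E.sing.Subsingleton ∧ ∀ ξ ∈ E.sing,
    (maximalIdeal (A.Z.presheaf.stalk ξ)).spanFinrank = n + 1 ∧
    (∃ (E₀ : AdicCompletion (maximalIdeal (A.Z.presheaf.stalk ξ)) (A.Z.presheaf.stalk ξ) ≃+*
        MvPowerSeries (Option (Fin n)) K)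
      (f₀ : A.Z.presheaf.stalk ξ) (c₀ : (Fin n → ℕ) → K) (w₀ : MvPowerSeries (Option (Fin n)) K),
      stalkIdeal E.J ξ = Ideal.span {f₀} ∧ IsUnit w₀ ∧
        E₀ (algebraMap _ _ f₀) = w₀ * ((X none : MvPowerSeries (Option (Fin n)) K) ^ p -
          rename (some : Fin n → Option (Fin n)) (ser p n K c₀))) ∧
    (∀ (E₀ : AdicCompletion (maximalIdeal (A.Z.presheaf.stalk ξ)) (A.Z.presheaf.stalk ξ) ≃+*
        MvPowerSeries (Option (Fin n)) K)
      (f₀ : A.Z.presheaf.stalk ξ) (c₀ : (Fin n → ℕ) → K) (w₀ : MvPowerSeries (Option (Fin n)) K),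
      stalkIdeal E.J ξ = Ideal.span {f₀} → IsUnit w₀ →
        E₀ (algebraMap _ _ f₀) = w₀ * ((X none : MvPowerSeries (Option (Fin n)) K) ^ p -
          rename (some : Fin n → Option (Fin n)) (ser p n K c₀)) → Isol p n K c₀)

/-- Unfolding `Regime.forcedAtom` at a state (definitional). [folklore] -/
theorem Regime.forcedAtom_apply (n : ℕ) (A : AmbientDatum p K) (E : IdealExponent A.Z) :
    Regime.forcedAtom (p := p) (K := K) n A E ↔
      E.b = p ∧ E.sing.Subsingleton ∧ ∀ ξ ∈ E.sing,
        (maximalIdeal (A.Z.presheaf.stalk ξ)).spanFinrank = n + 1 ∧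
        (∃ (E₀ : AdicCompletion (maximalIdeal (A.Z.presheaf.stalk ξ)) (A.Z.presheaf.stalk ξ) ≃+*
            MvPowerSeries (Option (Fin n)) K)
          (f₀ : A.Z.presheaf.stalk ξ) (c₀ : (Fin n → ℕ) → K) (w₀ : MvPowerSeries (Option (Fin n)) K),
          stalkIdeal E.J ξ = Ideal.span {f₀} ∧ IsUnit w₀ ∧
            E₀ (algebraMap _ _ f₀) = w₀ * ((X none : MvPowerSeries (Option (Fin n)) K) ^ p -
              rename (some : Fin n → Option (Fin n)) (ser p n K c₀))) ∧
        (∀ (E₀ : AdicCompletion (maximalIdeal (A.Z.presheaf.stalk ξ)) (A.Z.presheaf.stalk ξ) ≃+*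
            MvPowerSeries (Option (Fin n)) K)
          (f₀ : A.Z.presheaf.stalk ξ) (c₀ : (Fin n → ℕ) → K) (w₀ : MvPowerSeries (Option (Fin n)) K),
          stalkIdeal E.J ξ = Ideal.span {f₀} → IsUnit w₀ →
            E₀ (algebraMap _ _ f₀) = w₀ * ((X none : MvPowerSeries (Option (Fin n)) K) ^ p -
              rename (some : Fin n → Option (Fin n)) (ser p n K c₀)) → Isol p n K c₀) :=
  Iff.rfl

/-- In the forced-atom regime the exponent is the characteristic, `E.b = p` (pure logic; i.e. `Regime.forcedAtom n` is contained in
`Regime.bEqChar` of `…W46MohWindowSurface.lean`, not imported here). [folklore] -/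
theorem Regime.forcedAtom_b_eq {n : ℕ} {A : AmbientDatum p K} {E : IdealExponent A.Z}
    (h : Regime.forcedAtom (p := p) (K := K) n A E) : E.b = p :=
  h.1

/-- In the forced-atom regime the singular locus has at most one point (pure logic). [folklore] -/
theorem Regime.forcedAtom_sing_subsingleton {n : ℕ} {A : AmbientDatum p K} {E : IdealExponent A.Z}
    (h : Regime.forcedAtom (p := p) (K := K) n A E) : E.sing.Subsingleton :=
  h.2.1

/-! ## §2 The rung and its ∇-centred twin -/

/-- [OURS · L1 W4.6 rung (i)/(all `n`)] NOT a statement of the manuscript. **The rung**: the typed Th. 16.6 procedure with the literal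
centre rule TERMINATES in the forced-atom regime in `n + 1` variables — for EVERY `m`, every notion instance `N : Notions.{0} m` and every
reading `Rd`, `Terminates N Rd (Regime.forcedAtom n)`. Replaces the role of «Th. 16.6 (2)/(4): the procedure ends after finitely many
steps» (H. Hironaka, ms. 2017, p.84) RESTRICTED to regime (i) of RESCUE-SEED W4.6. Closed by name for `K` algebraically closed and
`0 < n` (`forcedAtomTerminates_holds`). [folklore] -/
def ForcedAtomTerminates (p : ℕ) [Fact p.Prime] (K : Type) [Field K] [CharP K p] (n : ℕ) : Prop :=
  ∀ (m : ℕ) (N : Notions.{0} m) (Rd : Reading p K N), Terminates N Rd (Regime.forcedAtom (p := p) (K := K) n)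

/-- [OURS · L1 W4.6 rung (i)/(all `n`)] NOT a statement of the manuscript. The ∇-CENTRED twin of `ForcedAtomTerminates`
(`TerminatesNabla`, every `m`, `N`, `Rd`); implied by the literal-rule form (`forcedAtomTerminatesNabla_of_terminates`). [folklore] -/
def ForcedAtomTerminatesNabla (p : ℕ) [Fact p.Prime] (K : Type) [Field K] [CharP K p] (n : ℕ) : Prop :=
  ∀ (m : ℕ) (N : Notions.{0} m) (Rd : Reading p K N), TerminatesNabla N Rd (Regime.forcedAtom (p := p) (K := K) n)

/-- Pure logic: the literal-rule rung gives the ∇-centred rung (every ∇-centred run is a run). [folklore] -/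
theorem forcedAtomTerminatesNabla_of_terminates {n : ℕ} (h : ForcedAtomTerminates p K n) : ForcedAtomTerminatesNabla p K n :=
  fun m N Rd => terminatesNabla_of_terminates (h m N Rd)

/-- Pure logic (antitone form): termination in the forced-atom regime gives termination in every SMALLER regime. [folklore] -/
theorem terminates_of_le_regime_forcedAtom {n m : ℕ} {N : Notions.{0} m} {Rd : Reading p K N} {Rg : Regime p K}
    (h : Terminates N Rd (Regime.forcedAtom (p := p) (K := K) n)) (hRg : ∀ A E, Rg A E → Regime.forcedAtom (p := p) (K := K) n A E) :
    Terminates N Rd Rg :=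
  fun r hr => h r fun k => hRg _ _ (hr k)

/-! ## §3 Closed by name (res-L1-s46-pv-2, p516034) -/

/-- [OURS · L1 W4.6 rung (i)/(all `n`)] **The rung `ForcedAtomTerminates p K n` HOLDS** for every prime `p`, every algebraically closed
field `K` of characteristic `p` and every `n ≥ 1` — literally res-L1-s46-pv-2's `ForcedAtom.terminates_of_le_forcedAtom` (p516034) at the
named regime with the identity inclusion. [folklore] -/
theorem forcedAtomTerminates_holds [IsAlgClosed K] {n : ℕ} (hn : 0 < n) : ForcedAtomTerminates p K n :=
  fun _ N Rd => ForcedAtom.terminates_of_le_forcedAtom hn N Rd _ (fun _ _ h => h)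

/-- [OURS · L1 W4.6 rung (i)/(all `n`)] the ∇-centred rung holds likewise (`K` algebraically closed, `0 < n`). [folklore] -/
theorem forcedAtomTerminatesNabla_holds [IsAlgClosed K] {n : ℕ} (hn : 0 < n) : ForcedAtomTerminatesNabla p K n :=
  forcedAtomTerminatesNabla_of_terminates (forcedAtomTerminates_holds hn)

end CampaignW46

end Summit.ResolutionOfSingularities.ResolutionOfSingularities.Theorems

end
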